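/-
Copyright (c) 2026. All rights reserved.
Released under Apache 2.0 license as described in the file LICENSE.
Authors: HodgeCM publication cell (pub-hodgecm), GR lane, seat GR-1 (`pub-hodgecm-own-real34`), after the third hand
`pub-hodgecm-own-crow`'s `Prop311PrintedCML2AllSignatures` (CM) and GR-2's `Prop311PrintedCML2`.
-/
import Literature.NumberTheory.GelbartRogawski1991.Prop311PrintedL2Model
import Literature.NumberTheory.GelbartRogawski1991.Prop311PrintedDarbouxLegAlongQuadExt
import Literature.NumberTheory.GelbartRogawski1991.Prop311RhoPsiL2Frame
import Literature.NumberTheory.Weil1964.AdelicMetaplecticUnitaryLegAlongHom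
import HarnessLib

-- buildfix G11b-3 recipe (LEDGER B13-1/B13-3): elaborate sequentially (dependent telescopes of the dual-pair datum).
set_option Elab.async false

/-!
# [GelbartRogawski1991, Prop. 3.1.1] AS PRINTED for the `L²(𝐀ⁿ)` model over an ARBITRARY quadratic `E/F`, FROM THE RECORD

Topic `NumberTheory/GelbartRogawski1991`; namespace `Literature.NumberTheory.GelbartRogawski1991.Prop311`.  KERNEL ONLY:
theorems; no definition, no named fact, no instance attribute beyond the local `secondCountableTopology_adeleRing`;
nothing of [GelbartRogawski1991] or [Weil1964] asserted; `Prop311AsPrinted` is untouched.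

This is the general-`(F, E, σ, δ)` form of own-crow's `prop311_CM_L2_of_irreducible` ∕ `prop311_CM_L2'`
(`Prop311PrintedCML2AllSignatures`, CM data `(L⁺, L, conj, imagUnit L)`), with the ONE CM-bound input of that chain — the
stage-1 record `GRConstruction.gru_shape` through J9 `compatibleSplitting_pairLineDatum_CM` — turned into the HYPOTHESIS

  `hrec : (pairLineDatum F E σ hσδ hδ hd f e hT).CompatibleSplitting`

(a continuous compatible splitting of the tree's dual-pair datum with line second factor on `U(T ⊗ 1 ⊗ₖ 1)(𝐀_F)`,
`T = diag(-2 d fᵢ)`), which is what the general-`(F, E, σ)` doubling construction is to deliver.  Everything else is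
general already and is used as is: GR-2's `legOfFrame` ∕ `continuous_legOfFrame_comp` ∕ `proj_legOfFrame_frame`
(`Prop311PrintedLegOfFrame`), `adelicMpCont.unitaryLegL2` (`AdelicMetaplecticUnitaryLegL2`), own-crow's Steinhaus–Weil
continuity `adelicMpCont.continuous_toOp_unitaryLegL2_comp_adelicPairHom` (`AdelicMetaplecticUnitaryLegAlongHom`, ANY
`E/F`, any signature), GR-1's irreducibility `irreducible_rep_comp_toCoordHeisenberg` (`Prop311RhoPsiL2Frame`), the model
`l2Model` (`Prop311PrintedL2Model`) and the socket `exists_isRationalSplitting_printed_conclusion_of_darbouxLeg_along`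
(`Prop311PrintedDarbouxLegAlongQuadExt`).

* **`prop311_L2_of_irreducible_of_record`** — `E/F` any quadratic extension of number fields (non-trivial automorphism
  `σ`, `δ ∈ E` with `σ δ = -δ ≠ 0`, `δ² = d`), `(V, Φ)` skew-Hermitian with a `Φ`-orthogonal `E`-basis `b`,
  `Φ(bᵢ, bᵢ) = fᵢ δ`, `φ = Tr Φ` non-degenerate, `ν` any Haar measure on `𝐀_Fⁿ`, `ρ = l2Model`: from `hrec` and the
  irreducibility of the model, THE rational splitting `i` (exists, unique) and clauses (1) ∧ (2) of Prop. 3.1.1 verbatim;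
* **`prop311_L2_of_record`** — the same with `hρi` DISCHARGED (`irreducible_rep_comp_toCoordHeisenberg`, `ψ_F` global):
  the body of `Prop311AsPrinted` for the `L²(𝐀_Fⁿ)` model at general `(F, E, σ)` from `hrec` ALONE;
* at CM data `(L⁺, L, conj, imagUnit L)` with `hrec := compatibleSplitting_pairLineDatum_CM …` (`gru_shape`) these are
  own-crow's `prop311_CM_L2_of_irreducible` ∕ `prop311_CM_L2'` (`cmL2Model = l2Model …`, `cmL2Model_eq_l2Model`).

Chain (general): `hrec` → `adelicMpContRelabel` (to the standard Gram matrix) → `continuous_toOp_unitaryLegL2_comp_adelicPairHom`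
(strong continuity along `relabel ∘ s`) → `legOfFrame` ∕ `continuous_legOfFrame_comp` →
`exists_isRationalSplitting_printed_conclusion_of_darbouxLeg_along`.  Written for the general-`(F, E, σ)` programme
(seat GR-1, §D «END modulo the record»).  Nothing in this file is a claim of the manuscripts adjudicated by the Hodge-CM cell.

## References
* [GelbartRogawski1991] S. Gelbart, J. Rogawski, Invent. Math. 105 (1991) 445–472, §3.1 p. 454 L17–42, Prop. 3.1.1
  p. 455 L1–2.
* [Weil1964] A. Weil, Acta Math. 111 (1964) 143–211, Chap. I n° 11–13, Chap. III n° 37–39.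
* [HewittRoss1979] E. Hewitt, K. A. Ross, *Abstract Harmonic Analysis I*, 2nd ed. (1979), Thm. 22.18.
-/

set_option autoImplicit false

noncomputable section

open NumberField MeasureTheory
open scoped TensorProduct Matrix Kronecker
open Literature.NumberTheory.Automorphic
open Literature.RepresentationTheory.HeisenbergGroup
open Literature.RepresentationTheory.Unitary
open Literature.NumberTheory.Weil1964

namespace Literature.NumberTheory.GelbartRogawski1991

namespace Prop311

open UnitaryDualPair

section Quadratic

variable (F : Type) [Field F] [NumberField F]
variable (E : Type) [Field E] [NumberField E] [Algebra F E] [Algebra.IsQuadraticExtension F E]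
variable (σ : E ≃ₐ[F] E) {δ : E} (hσδ : σ δ = -δ) (hδ : δ ≠ 0) {d : F} (hd : δ * δ = algebraMap F E d)
variable (V : Type) [AddCommGroup V] [Module F V] [Module E V] [IsScalarTower F E V]
variable {n : ℕ} (b : Module.Basis (Fin n) E V) (Φ : V →ₗ[F] V →ₗ[F] E) (f : Fin n → F)
variable (e : Fin n × Fin 1 ≃ Fin n) (he : ∀ k : Fin n, (e.symm k).1 = k)
variable (hΦ₁ : ∀ (a : E) (x y : V), Φ (a • x) y = a * Φ x y)
  (hΦ₂ : ∀ (a : E) (x y : V), Φ x (a • y) = Φ x y * σ a)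
  (hb : ∀ i j, i ≠ j → Φ (b i) (b j) = 0)
  (hf : ∀ i, Φ (b i) (b i) = algebraMap F E (f i) * δ)
  (hφ : (traceForm F E V Φ).Nondegenerate)
variable [MeasurableSpace (AdeleRing (𝓞 F) F)] [BorelSpace (AdeleRing (𝓞 F) F)]
  (ν : Measure (Fin n → AdeleRing (𝓞 F) F)) [ν.IsAddHaarMeasure]
  (hψc : Continuous (adeleAddChar F : AdeleRing (𝓞 F) F → Circle))
  (hβc : ∀ y : Fin n → AdeleRing (𝓞 F) F,
    Continuous fun u : Fin n → AdeleRing (𝓞 F) F => adelicForm F (Fin n) (1 : Matrix (Fin n) (Fin n) (AdeleRing (𝓞 F) F)) u y)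

include he in
/-- **[GelbartRogawski1991, Prop. 3.1.1] AS PRINTED FOR THE `L²(𝐀_Fⁿ)` MODEL over an arbitrary quadratic `E/F`, FROM THE
RECORD — every signature.**  Inputs: `hrec`, a continuous compatible splitting of the dual-pair line datum
`pairLineDatum F E σ hσδ hδ hd f e hT` (for any invertibility witness `hT` of `T = diag(-2 d fᵢ)`), and `hρi`, the
irreducibility of `ρ = l2Model` (the binder `_hρi` of `Prop311AsPrinted`).  Conclusion: THE rational splitting `i` of `π`
over `Sp_F(W)` (exists, unique) and clauses (1) ∧ (2) of Prop. 3.1.1 verbatim for this model.  The operator continuity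
along the splitting is `adelicMpCont.continuous_toOp_unitaryLegL2_comp_adelicPairHom` (Steinhaus–Weil on the locally compact
second-countable `U(T ⊗ 1 ⊗ₖ 1)(𝐀_F)`, any `E/F`, any signature).
[cite: GelbartRogawski1991, §3.1 p. 454 L17–42; Prop. 3.1.1 p. 455 L1–2; Weil1964, Chap. I n° 13, Chap. III n° 37–39]
[cite: HewittRoss1979, Thm. 22.18] -/
theorem prop311_L2_of_irreducible_of_record (hΦ₃ : ∀ x y : V, Φ y x = -σ (Φ x y))
    (hT : IsUnit (symplecticGram F d f).det)
    (hrec : (pairLineDatum F E σ hσδ hδ hd f e hT).CompatibleSplitting)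
    (hρi : ∀ K : Submodule ℂ (Lp ℂ 2 ν), IsClosed (K : Set (Lp ℂ 2 ν)) →
      (∀ (h : AdelicHeisenberg F E V Φ), ∀ g ∈ K,
        l2Model F E σ hσδ hδ hd V b Φ f e he hΦ₁ hΦ₂ hb hf hφ ν hψc hβc h g ∈ K) → K = ⊥ ∨ K = ⊤) :
    ∃ i : ratSp F E V Φ →* adelicMp F E V Φ (l2Model F E σ hσδ hδ hd V b Φ f e he hΦ₁ hΦ₂ hb hf hφ ν hψc hβc),
      IsRationalSplitting F E V Φ _ i ∧
      (∀ i' : ratSp F E V Φ →* adelicMp F E V Φ (l2Model F E σ hσδ hδ hd V b Φ f e he hΦ₁ hΦ₂ hb hf hφ ν hψc hβc),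
        IsRationalSplitting F E V Φ _ i' → i' = i) ∧
      (∃ s : adelicUnitary F E V Φ →* adelicMp F E V Φ (l2Model F E σ hσδ hδ hd V b Φ f e he hΦ₁ hΦ₂ hb hf hφ ν hψc hβc),
          ∀ g : adelicUnitary F E V Φ,
            projEnd F E V Φ _ (s g) =
              ((g : AdelicSpace F V ≃ₗ[AdeleRing (𝓞 F) F] AdelicSpace F V) :
                AdelicSpace F V →ₗ[AdeleRing (𝓞 F) F] AdelicSpace F V)) ∧
        ∃ s : adelicUnitary F E V Φ →* adelicMp F E V Φ (l2Model F E σ hσδ hδ hd V b Φ f e he hΦ₁ hΦ₂ hb hf hφ ν hψc hβc),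
          Continuous s ∧
          (∀ g : adelicUnitary F E V Φ,
            projEnd F E V Φ _ (s g) =
              ((g : AdelicSpace F V ≃ₗ[AdeleRing (𝓞 F) F] AdelicSpace F V) :
                AdelicSpace F V →ₗ[AdeleRing (𝓞 F) F] AdelicSpace F V)) ∧
          ∀ g : adelicUnitary F E V Φ,
            IsRationalPoint F E V Φ (g : AdelicSpace F V ≃ₗ[AdeleRing (𝓞 F) F] AdelicSpace F V) → s g ∈ i.range := by
  haveI := secondCountableTopology_adeleRing F
  -- frame data (explicit terms; `have` before `rcases` under the large goal)
  have hT' := isUnit_det_lineGram_of_nondegenerate F E σ hδ hd V b Φ f hΦ₁ hΦ₂ hb hf hφ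
  have hT1 : IsUnit (1 : Matrix (Fin n) (Fin n) (AdeleRing (𝓞 F) F)).det := by
    rw [Matrix.det_one]; exact isUnit_one
  -- the two analytic inputs of the `L²` leg, discharged
  have hdR : DenseRange (schwartzBruhatToL2 F (Fin n) ν) := Weil1964.denseRange_schwartzBruhatToL2 ν
  have hall := adelicMpCont.toOp_mem_scaledIsometries_schwartzBruhatToL2
    (1 : Matrix (Fin n) (Fin n) (AdeleRing (𝓞 F) F)) hT1 ν
  have hψb := adelicMpCont.continuous_toOp_unitaryLegL2 ν (1 : Matrix (Fin n) (Fin n) (AdeleRing (𝓞 F) F)) hψc hβc hdR hall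
  have hψ := adelicMpCont.proj_unitaryLegL2 ν (1 : Matrix (Fin n) (Fin n) (AdeleRing (𝓞 F) F)) hψc hβc hdR hall
  -- the record, read at the frame's invertibility witness (proof-irrelevant)
  have hGR : (pairLineDatum F E σ hσδ hδ hd f e hT').CompatibleSplitting := hrec
  rcases hGR with ⟨s, hsc, hs⟩
  -- the relabelled splitting `relabel ∘ s : U(T ⊗ 1 ⊗ₖ 1)(𝐀_F) →* Mp_ψ(W_𝐀)ᶜᵒⁿᵗ` (standard Gram matrix), continuous
  have hrc := continuous_adelicMpContRelabel F (Fin n) (legGL F f e hT') (one_mul_legGL F f e hT')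
  have hs'c : Continuous ((adelicMpContRelabel F (Fin n) (legGL F f e hT') (one_mul_legGL F f e hT')).toMonoidHom.comp s) :=
    hrc.comp hsc
  -- continuity of the leg along `relabel ∘ s` (symplectic orbit maps: tautological; operators: Steinhaus–Weil in `L²`)
  have hcont := continuous_legOfFrame_comp
    (darbouxFrame F E σ hσδ hδ hd V b f e hT')
    (adelicTraceForm_darbouxFrame F E σ hσδ hδ hd V b Φ f e he hT' hΦ₁ hΦ₂ hb hf)
    (l2Model F E σ hσδ hδ hd V b Φ f e he hΦ₁ hΦ₂ hb hf hφ ν hψc hβc)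
    (SchrodingerHaar.rep (adelicForm F (Fin n) (1 : Matrix (Fin n) (Fin n) (AdeleRing (𝓞 F) F)))
      (adeleAddChar F) hψc hβc ν)
    (fun _ _ => rfl)
    (adelicMpCont.unitaryLegL2 ν (1 : Matrix (Fin n) (Fin n) (AdeleRing (𝓞 F) F)) hψc hβc hdR hall) hψb
    (fun g => adelicMpContRelabel F (Fin n) (legGL F f e hT') (one_mul_legGL F f e hT') (s g))
    (fun c => (((adelicMpCont.continuous_proj_apply c).comp (hrc.comp hsc)).congr fun g =>
      congrArg (fun q : symplecticGroup (polar (adelicForm F (Fin n) (1 : Matrix (Fin n) (Fin n) (AdeleRing (𝓞 F) F)))) =>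
        ((q : ((Fin n → AdeleRing (𝓞 F) F) × (Fin n → AdeleRing (𝓞 F) F)) ≃ₗ[AdeleRing (𝓞 F) F]
          ((Fin n → AdeleRing (𝓞 F) F) × (Fin n → AdeleRing (𝓞 F) F))) c))
        (hψ _).symm))
    (fun g' => adelicMpCont.continuous_toOp_unitaryLegL2_comp_adelicPairHom F
      (1 : Matrix (Fin n) (Fin n) (AdeleRing (𝓞 F) F)) hT1 ν hψc hβc hdR hall σ n 1 _ _ _ hs'c g')
  exact exists_isRationalSplitting_printed_conclusion_of_darbouxLeg_along F E σ hσδ hδ hd V b Φ f e he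
    (l2Model F E σ hσδ hδ hd V b Φ f e he hΦ₁ hΦ₂ hb hf hφ ν hψc hβc) hΦ₁ hΦ₂ hΦ₃ hb hf hφ hT'
    (norm_l2Model F E σ hσδ hδ hd V b Φ f e he hΦ₁ hΦ₂ hb hf hφ ν hψc hβc) hρi _
    (proj_legOfFrame_frame _ _ _ _ (fun _ _ => rfl) _ hψb hψ) ⟨s, hs, hcont⟩

include he in
/-- **[GelbartRogawski1991, Prop. 3.1.1] AS PRINTED FOR THE `L²(𝐀_Fⁿ)` MODEL over an arbitrary quadratic `E/F` FROM THE
RECORD ALONE.**  As `prop311_L2_of_irreducible_of_record`, with the irreducibility of `l2Model` supplied by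
`irreducible_rep_comp_toCoordHeisenberg` (`Prop311RhoPsiL2Frame`; `ψ_F` is a global character, `isGlobalAddChar_adeleAddChar`):
for EVERY quadratic extension `E/F` of number fields, every skew-Hermitian `(V, Φ)` with a `Φ`-orthogonal basis (any
signature at every place), every line enumeration `e`, every Haar measure `ν`, a continuous compatible splitting of the
dual-pair line datum yields THE rational splitting `i` of `π` over `Sp_F(W)` (exists uniquely) and clauses (1) ∧ (2) of
Prop. 3.1.1 verbatim for `ρ = l2Model`.
[cite: GelbartRogawski1991, §3.1 p. 454 L17–42; Prop. 3.1.1 p. 455 L1–2; Weil1964, Chap. I n° 11–13, Chap. III n° 37–39]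
[cite: HewittRoss1979, Thm. 22.18] -/
theorem prop311_L2_of_record (hΦ₃ : ∀ x y : V, Φ y x = -σ (Φ x y))
    (hT : IsUnit (symplecticGram F d f).det)
    (hrec : (pairLineDatum F E σ hσδ hδ hd f e hT).CompatibleSplitting) :
    ∃ i : ratSp F E V Φ →* adelicMp F E V Φ (l2Model F E σ hσδ hδ hd V b Φ f e he hΦ₁ hΦ₂ hb hf hφ ν hψc hβc),
      IsRationalSplitting F E V Φ _ i ∧
      (∀ i' : ratSp F E V Φ →* adelicMp F E V Φ (l2Model F E σ hσδ hδ hd V b Φ f e he hΦ₁ hΦ₂ hb hf hφ ν hψc hβc),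
        IsRationalSplitting F E V Φ _ i' → i' = i) ∧
      (∃ s : adelicUnitary F E V Φ →* adelicMp F E V Φ (l2Model F E σ hσδ hδ hd V b Φ f e he hΦ₁ hΦ₂ hb hf hφ ν hψc hβc),
          ∀ g : adelicUnitary F E V Φ,
            projEnd F E V Φ _ (s g) =
              ((g : AdelicSpace F V ≃ₗ[AdeleRing (𝓞 F) F] AdelicSpace F V) :
                AdelicSpace F V →ₗ[AdeleRing (𝓞 F) F] AdelicSpace F V)) ∧
        ∃ s : adelicUnitary F E V Φ →* adelicMp F E V Φ (l2Model F E σ hσδ hδ hd V b Φ f e he hΦ₁ hΦ₂ hb hf hφ ν hψc hβc),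
          Continuous s ∧
          (∀ g : adelicUnitary F E V Φ,
            projEnd F E V Φ _ (s g) =
              ((g : AdelicSpace F V ≃ₗ[AdeleRing (𝓞 F) F] AdelicSpace F V) :
                AdelicSpace F V →ₗ[AdeleRing (𝓞 F) F] AdelicSpace F V)) ∧
          ∀ g : adelicUnitary F E V Φ,
            IsRationalPoint F E V Φ (g : AdelicSpace F V ≃ₗ[AdeleRing (𝓞 F) F] AdelicSpace F V) → s g ∈ i.range :=
  prop311_L2_of_irreducible_of_record F E σ hσδ hδ hd V b Φ f e he hΦ₁ hΦ₂ hb hf hφ ν hψc hβc hΦ₃ hT hrec fun K hKc hK =>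
    irreducible_rep_comp_toCoordHeisenberg
      (darbouxFrame F E σ hσδ hδ hd V b f e (isUnit_det_lineGram_of_nondegenerate F E σ hδ hd V b Φ f hΦ₁ hΦ₂ hb hf hφ))
      (adelicTraceForm_darbouxFrame F E σ hσδ hδ hd V b Φ f e he
        (isUnit_det_lineGram_of_nondegenerate F E σ hδ hd V b Φ f hΦ₁ hΦ₂ hb hf hφ) hΦ₁ hΦ₂ hb hf)
      (adeleAddChar F) hψc hβc ν (isGlobalAddChar_adeleAddChar _) K hKc hK

end Quadratic

end Prop311

end Literature.NumberTheory.GelbartRogawski1991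

end
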